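import Summits.AtomisticToContinuum.BoseEinsteinCondensation.Theorems.BECThomsonPrincipleFibreConductanceStubTwoScaleSplitHelpers
import Literature.MathematicalPhysics.QuantumManyBody.GeneralizedPoincareProofs
import Literature.MathematicalPhysics.QuantumManyBody.BoseGasFreeDirichletBEC
import HarnessLib

/-!
# Route `BECThomsonPrinciple`, crux `FibreConductance` (stmt-AtomisticToContinuum-9480),
# line `conditional-law-poincare` — stub `stub_weightedSobolevPoincare`:
# WEIGHTED SOBOLEV–POINCARÉ ON THE TILING CUBES

`weightedSobolevPoincare_cubeSet` (the helper the lead wires as `stub_weightedSobolevPoincare`):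
there is `C < ∞` such that for every `L > 0`, block count `ν`, cube `Q = cubeSet L ν Q` of the tiling
of the fibre `[0,L)³` into `(ν+1)³` half-open cubes of side `ℓ = L/(ν+1)`, every `C¹` function
`f : ℝ³ → ℂ` and every continuous positive weight `w`,
`∫_Q |f − ⨍_Q f|² ≤ C · (∫_Q w|∇f|²) · (∫_Q w^{-3/2})^{2/3}` — a Poincaré inequality with FLAT left
side and weighted right side whose "constant" is the explicit hole moment `(∫_Q w^{-3/2})^{2/3}`, not
the (uncontrollable) Poincaré constant of the weight.

Proof (deterministic, three steps):
* `lintegral_gradNorm_rpow_le_weighted` — HÖLDER with exponents `5/3`, `5/2`: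
  `∫_S |∇g|^{6/5} = ∫_S (W|∇g|²)^{3/5} · W^{-3/5} ≤ (∫_S W|∇g|²)^{3/5} (∫_S W^{-3/2})^{2/5}` for a weight
  `0 < W < ∞` (`ENNReal.lintegral_mul_le_Lp_mul_Lq`);
* `weightedSobolevPoincare_cell` — on the cell `[0,ℓ)³`: the tree's Poincaré–Sobolev inequality for
  all `C¹` functions `GenPoincare.poincare_sobolev_cube` (`‖g − ⨍g‖_{L²} ≤ C_PS ‖∇g‖_{L^{6/5}}`), the
  Hölder step, and squaring (`GenPoincare.rpow_holder_split`): constant `C_PS²`;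
* `cubeSet_eq_cellShift` + translation invariance of Lebesgue measure
  (`setLIntegral_cell_comp_add`, `setIntegral_cell_comp_add`, `gradSqC_comp_add`): the cube `Q` is the
  translate `ℓQ + [0,ℓ)³ = cellShift ℓ (subOffset ℓ Q)`, and all four integrals (including the Bochner
  average `⨍_Q f`) transform alike under `g = f(· + ℓQ)`.

References: LSSY2005 Lemma 4.1 (the Poincaré–Sobolev + Hölder step of its proof, here with a weight);
used only through the tree's proved `GenPoincare.poincare_sobolev_cube`.
-/

noncomputable section

namespace Summit.AtomisticToContinuum.BoseEinsteinCondensation.Cruxes.FibreConductance.ConditionalLawPoincare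

open MeasureTheory Set
open scoped ENNReal
open Literature.MathematicalPhysics.QuantumManyBody.BoseGas
open Summit.AtomisticToContinuum.BoseEinsteinCondensation.Cruxes.FibreConductance.ParsevalShellBootstrap
open Summit.AtomisticToContinuum.BoseEinsteinCondensation.Cruxes.FibreConductance.HealingSplitKineticDefect

/-! ### Hölder: `∫ |∇g|^{6/5} ≤ (∫ W|∇g|²)^{3/5} (∫ W^{-3/2})^{2/5}` -/

/-- **Hölder with a weight** (exponents `5/3` and `5/2`): for a measurable weight `0 < W < ∞`,
`∫_S |∇g|^{6/5} ≤ (∫_S W |∇g|²)^{3/5} · (∫_S (W⁻¹)^{3/2})^{2/5}`, from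
`|∇g|^{6/5} = (W|∇g|²)^{3/5} · (W⁻¹)^{3/5}`. [folklore] -/
theorem lintegral_gradNorm_rpow_le_weighted {S : Set Space} {g : Space → ℂ} {W : Space → ℝ≥0∞}
    (hg : Measurable (gradSqC g)) (hW : Measurable W) (h0 : ∀ x, W x ≠ 0) (htop : ∀ x, W x ≠ ⊤) :
    ∫⁻ x in S, GenPoincare.gradNorm g x ^ ((6 : ℝ) / 5) ≤
      (∫⁻ x in S, W x * gradSqC g x) ^ ((3 : ℝ) / 5) *
        (∫⁻ x in S, (W x)⁻¹ ^ ((3 : ℝ) / 2)) ^ ((2 : ℝ) / 5) := by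
  have hpq : Real.HolderConjugate (5 / 3) (5 / 2) :=
    Real.holderConjugate_iff.2 ⟨by norm_num, by norm_num⟩
  have hpt : ∀ x, GenPoincare.gradNorm g x ^ ((6 : ℝ) / 5) =
      (W x * gradSqC g x) ^ ((3 : ℝ) / 5) * (W x)⁻¹ ^ ((3 : ℝ) / 5) := by
    intro x
    rw [← ENNReal.mul_rpow_of_nonneg _ _ (by norm_num), mul_right_comm,
      ENNReal.mul_inv_cancel (h0 x) (htop x), one_mul, GenPoincare.gradNorm_rpow]
    norm_num
  simp_rw [hpt]
  have h := ENNReal.lintegral_mul_le_Lp_mul_Lq (volume.restrict S) hpq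
    (f := fun x => (W x * gradSqC g x) ^ ((3 : ℝ) / 5)) (g := fun x => (W x)⁻¹ ^ ((3 : ℝ) / 5))
    ((hW.mul hg).pow_const ((3 : ℝ) / 5)).aemeasurable
    ((hW.inv.pow_const ((3 : ℝ) / 5)).aemeasurable)
  simp only [Pi.mul_apply] at h
  refine h.trans (le_of_eq ?_)
  congr 1
  · rw [show (1 : ℝ) / (5 / 3) = 3 / 5 by norm_num]
    congr 1
    refine lintegral_congr fun x => ?_
    rw [← ENNReal.rpow_mul, show (3 : ℝ) / 5 * (5 / 3) = 1 by norm_num, ENNReal.rpow_one]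
  · rw [show (1 : ℝ) / (5 / 2) = 2 / 5 by norm_num]
    congr 1
    refine lintegral_congr fun x => ?_
    rw [← ENNReal.rpow_mul, show (3 : ℝ) / 5 * (5 / 2) = 3 / 2 by norm_num]

/-! ### The weighted Poincaré–Sobolev inequality on the cell `[0,ℓ)³` -/

/-- **Weighted Poincaré–Sobolev on the cell**: if `‖g − ⨍g‖_{L²(K)} ≤ C ‖∇g‖_{L^{6/5}(K)}` on every
cell `K = [0,ℓ)³` for all `C¹` `g` (the tree's `GenPoincare.poincare_sobolev_cube`), then for every
continuous positive weight `u`,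
`∫_K |g − ⨍_K g|² ≤ C² · (∫_K u|∇g|²) · (∫_K u^{-3/2})^{2/3}` (Hölder and squaring).
[cite: LSSY2005, Lemma 4.1] -/
theorem weightedSobolevPoincare_cell {C : ℝ≥0∞}
    (H : ∀ (L : ℝ), 0 < L → ∀ (f : Space → ℂ), ContDiff ℝ 1 f →
      (∫⁻ x in cell L, ‖f x - ⨍ y in cell L, f y‖ₑ ^ (2 : ℝ)) ^ (1 / 2 : ℝ) ≤
        C * (∫⁻ x in cell L, GenPoincare.gradNorm f x ^ ((6 : ℝ) / 5)) ^ ((5 : ℝ) / 6))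
    {ℓ : ℝ} (hℓ : 0 < ℓ) {g : Space → ℂ} (hg : ContDiff ℝ 1 g) {u : Space → ℝ}
    (hu : Continuous u) (hu0 : ∀ x, 0 < u x) :
    ∫⁻ x in cell ℓ, ‖g x - ⨍ y in cell ℓ, g y‖ₑ ^ 2 ≤
      C ^ 2 * (∫⁻ x in cell ℓ, ENNReal.ofReal (u x) * gradSqC g x) *
        (∫⁻ x in cell ℓ, ENNReal.ofReal (u x ^ (-(3 / 2 : ℝ)))) ^ (2 / 3 : ℝ) := by
  set m : ℂ := ⨍ y in cell ℓ, g y with hm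
  set a : ℝ≥0∞ := ∫⁻ x in cell ℓ, ENNReal.ofReal (u x) * gradSqC g x with ha
  set α : ℝ≥0∞ := ∫⁻ x in cell ℓ, ENNReal.ofReal (u x ^ (-(3 / 2 : ℝ))) with hα
  -- Hölder: `∫_K |∇g|^{6/5} ≤ a^{3/5} α^{2/5}`
  have hI : ∫⁻ x in cell ℓ, GenPoincare.gradNorm g x ^ ((6 : ℝ) / 5) ≤
      a ^ ((3 : ℝ) / 5) * α ^ ((2 : ℝ) / 5) := by
    have h := lintegral_gradNorm_rpow_le_weighted (S := cell ℓ) (Dyson.measurable_gradSqC hg)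
      (ENNReal.measurable_ofReal.comp hu.measurable)
      (fun x => (ENNReal.ofReal_pos.2 (hu0 x)).ne') (fun x => ENNReal.ofReal_ne_top)
    have hw : ∀ x, (ENNReal.ofReal (u x))⁻¹ ^ ((3 : ℝ) / 2) = ENNReal.ofReal (u x ^ (-(3 / 2 : ℝ))) :=
      fun x => by
        rw [ENNReal.inv_rpow, ← ENNReal.rpow_neg, ENNReal.ofReal_rpow_of_pos (hu0 x)]
    simp only [Function.comp_apply, hw] at h
    exact h
  have hX : ∫⁻ x in cell ℓ, ‖g x - m‖ₑ ^ 2 =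
      ((∫⁻ x in cell ℓ, ‖g x - m‖ₑ ^ (2 : ℝ)) ^ (1 / 2 : ℝ)) ^ (2 : ℝ) := by
    rw [← ENNReal.rpow_mul, show (1 : ℝ) / 2 * 2 = 1 by norm_num, ENNReal.rpow_one]
    simp_rw [ENNReal.rpow_two]
  calc ∫⁻ x in cell ℓ, ‖g x - m‖ₑ ^ 2
      = ((∫⁻ x in cell ℓ, ‖g x - m‖ₑ ^ (2 : ℝ)) ^ (1 / 2 : ℝ)) ^ (2 : ℝ) := hX
    _ ≤ (C * (∫⁻ x in cell ℓ, GenPoincare.gradNorm g x ^ ((6 : ℝ) / 5)) ^ ((5 : ℝ) / 6)) ^ (2 : ℝ) :=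
        ENNReal.rpow_le_rpow (H ℓ hℓ g hg) (by norm_num)
    _ ≤ (C * (a ^ ((3 : ℝ) / 5) * α ^ ((2 : ℝ) / 5)) ^ ((5 : ℝ) / 6)) ^ (2 : ℝ) := by gcongr
    _ = C ^ 2 * (a * α ^ ((2 : ℝ) / 3)) := by
        rw [ENNReal.mul_rpow_of_nonneg _ _ (by norm_num), GenPoincare.rpow_holder_split,
          ENNReal.rpow_two]
    _ = C ^ 2 * a * α ^ (2 / 3 : ℝ) := by rw [mul_assoc]

/-! ### The tiling cube as a translated cell, and transport of the four integrals -/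

/-- The tiling cube `Q` is the translate `ℓQ + [0,ℓ)³` of the cell of side `ℓ = L/(ν+1)`. [folklore] -/
theorem cubeSet_eq_cellShift (L : ℝ) (ν : ℕ) (Q : Fin 3 → Fin (ν + 1)) :
    cubeSet L ν Q = cellShift (side L ν) (subOffset (side L ν) Q) := by
  ext y
  simp only [cubeSet, Set.mem_setOf_eq, Set.mem_Ico, mem_cellShift, subOffset_apply]
  refine forall_congr' fun l => ?_
  constructor <;> rintro ⟨h1, h2⟩ <;> constructor <;> linarith

/-- Translated cells have the volume of the cell. [folklore] -/
theorem volume_cellShift (ℓ : ℝ) (a : Space) : volume (cellShift ℓ a) = volume (cell ℓ) := by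
  rw [← setLIntegral_one, ← setLIntegral_one, ← setLIntegral_cell_comp_add ℓ (fun _ => 1) a]

/-- The flat average transforms under translation: `⨍_{a + K} f = ⨍_K f(· + a)`. [folklore] -/
theorem setAverage_cellShift (ℓ : ℝ) (f : Space → ℂ) (a : Space) :
    ⨍ x in cellShift ℓ a, f x = ⨍ x in cell ℓ, f (x + a) := by
  rw [setAverage_eq, setAverage_eq, measureReal_def, measureReal_def, volume_cellShift,
    setIntegral_cell_comp_add]

/-! ### The stub -/

/-- **`stub_weightedSobolevPoincare` — WEIGHTED SOBOLEV–POINCARÉ ON THE TILING CUBES.** There is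
`C < ∞` such that for every `L > 0`, block count `ν`, cube `Q` of the tiling of `[0,L)³` into
`(ν+1)³` cubes of side `ℓ = L/(ν+1)`, every `C¹` function `f : ℝ³ → ℂ` and every continuous positive
weight `w`, `∫_Q |f − ⨍_Q f|² ≤ C · (∫_Q w|∇f|²) · (∫_Q w^{-3/2})^{2/3}`. Proof: `Q = ℓQ + [0,ℓ)³`;
the tree's Poincaré–Sobolev inequality on cubes `GenPoincare.poincare_sobolev_cube` for the translate
`f(· + ℓQ)`; Hölder `∫|∇f|^{6/5} ≤ (∫w|∇f|²)^{3/5}(∫w^{-3/2})^{2/5}`; `C = C_PS²`.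
[cite: LSSY2005, Lemma 4.1] -/
theorem weightedSobolevPoincare_cubeSet :
    ∃ C : ℝ≥0∞, C ≠ ⊤ ∧ ∀ (L : ℝ), 0 < L → ∀ (ν : ℕ) (Q : Fin 3 → Fin (ν + 1)) (f : Space → ℂ),
      ContDiff ℝ 1 f → ∀ w : Space → ℝ, Continuous w → (∀ y, 0 < w y) →
        ∫⁻ y in cubeSet L ν Q, ‖f y - ⨍ z in cubeSet L ν Q, f z‖ₑ ^ 2 ≤
          C * (∫⁻ y in cubeSet L ν Q, ENNReal.ofReal (w y) * gradSqC f y) *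
            (∫⁻ y in cubeSet L ν Q, ENNReal.ofReal (w y ^ (-(3 / 2 : ℝ)))) ^ (2 / 3 : ℝ) := by
  obtain ⟨C, hCtop, H⟩ := GenPoincare.poincare_sobolev_cube
  refine ⟨C ^ 2, ENNReal.pow_ne_top hCtop, fun L hL ν Q f hf w hw hw0 => ?_⟩
  set ℓ : ℝ := side L ν with hℓdef
  have hℓ : 0 < ℓ := side_pos hL ν
  set a : Space := subOffset ℓ Q with hadef
  set g : Space → ℂ := fun z => f (z + a) with hgdef
  have hg : ContDiff ℝ 1 g := hf.comp (contDiff_id.add contDiff_const)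
  have hu : Continuous fun z => w (z + a) := hw.comp (continuous_id.add continuous_const)
  have key := weightedSobolevPoincare_cell H hℓ hg hu (fun z => hw0 (z + a))
  -- transport the four integrals from `cell ℓ` to `cubeSet L ν Q = cellShift ℓ a`
  rw [cubeSet_eq_cellShift, setAverage_cellShift,
    ← setLIntegral_cell_comp_add ℓ (fun y => ‖f y - ⨍ x in cell ℓ, f (x + a)‖ₑ ^ 2) a,
    ← setLIntegral_cell_comp_add ℓ (fun y => ENNReal.ofReal (w y) * gradSqC f y) a,
    ← setLIntegral_cell_comp_add ℓ (fun y => ENNReal.ofReal (w y ^ (-(3 / 2 : ℝ)))) a]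
  simp only [← gradSqC_comp_add f a]
  exact key

end Summit.AtomisticToContinuum.BoseEinsteinCondensation.Cruxes.FibreConductance.ConditionalLawPoincare

end
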